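import Mathlib
import Literature.AlgebraicGeometry.Resolution.CutkoskyOrderTauBlowup
import HarnessLib

/-!
# Cutkosky 2009, Lemma 5.1 (2) for an approximate hyperplane: a near point of the blown-up point lies on its strict transform (PROVED)

Topic: `Literature/AlgebraicGeometry/Resolution`.  S. D. Cutkosky, *Resolution of singularities for
3-folds in positive characteristic*, Amer. J. Math. **131** (2009) 59–127 [cite: Cutkosky2009],
Lemma 5.1 (2), p. 17 l. 46–50 of the author version: "`ν_q(𝓘_1) = r` implies `q` is on the
strict transform `M_p'` of `M_p`", for `M_p = V(ℓ)` an approximate HYPERPLANE through the blown-up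
point `p` — the clause `… → ℓ ∈ (u 1, u 2) + 𝔪²` of the point branch of the named fact
`Cutkosky2009_Lemma5_1` (`CutkoskyOrderTauBlowup.lean`), which is thereby PROVED
(`Cutkosky2009_L5_1_pointHyperplane`).  It is the glue "(g1)" of the discharge programme of
`Cutkosky2009_Thm10_18` (proof of Thm. 10.18, p. 36 l. 84 – p. 37 l. 50: "`R_n → R_{n+1}` must be a
Tr1 or Tr2 transformation of `R_n` by Lemma 5.1, since `V(z_n)` is an approximate manifold of
`I_n`"): it locates the next point of the sequence on the exceptional plane.

## The elementary argument (formalised in a general local frame)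

Let `φ : R → R'` be a local homomorphism of local rings presenting the first chart of the blow-up
of the closed point at its origin: `𝔪_R = (u 0, u 1, u 2)`, `φ(u 0) = x'`, `φ(u 1) = x' u'_1`,
`φ(u 2) = x' u'_2` with `u'_1, u'_2 ∈ 𝔪_{R'}`.  If some `g ∈ J` is `≡ a y^μ (mod 𝔪^{μ+1})` with `a` a
unit ("`b_{00r} ≠ 0`") and the linear part of `y` has a `u 0`-component (`y ∉ (u 1, u 2) + 𝔪²`),
then `φ(y) = x'·(unit)` and `φ(g) = x'^μ·(unit)`, so the weak transform `(J R' : x'^μ)` is the unit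
ideal — the order has dropped to `0`.  Contrapositively, if the weak transform still has order
`μ ≥ 1`, then `y ∈ (u 1, u 2) + 𝔪²`: the point `ū_1 = ū_2 = 0` of the exceptional plane lies on the
line `ȳ = 0`, the trace of the strict transform of `V(y)`.

## What is PROVED (theorems only; no definition, no fact)

* `colon_map_eq_top_of_monic` — the general statement above;
* `Cutkosky2009_L5_1_pointHyperplane` — the hyperplane clause of `Cutkosky2009_Lemma5_1` (point
  branch) in the chart frame of `CutkoskyOrderTauBlowup.lean` (`IsPointChart`, `IsWeakTransform`),
  for `k⟦x, y, z⟧` over any field `k`.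

AI-written; weaker than expert review.

## Sources

* S. D. Cutkosky, Amer. J. Math. 131 (2009), Lemma 5.1 (2) p. 17 l. 46–50; §5 p. 17 l. 35–45
  (approximate manifolds); proof of Thm. 10.18 p. 36 l. 84 – p. 37 l. 50. [Cutkosky2009]
-/

noncomputable section

open IsLocalRing

namespace Literature.AlgebraicGeometry.Resolution.Cutkosky2009

universe u

section General

variable {R R' : Type u} [CommRing R] [IsLocalRing R] [CommRing R'] [IsLocalRing R']

/-- **The weak transform of a monic ideal at a point off the strict transform of `V(y)` is the unit
ideal.**  `φ` a local homomorphism presenting the origin of the first chart of the point blow-up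
(`𝔪 = (u 0, u 1, u 2)`, `φ(u 0) = x'`, `φ(u i) = x' u'_i`, `u'_i ∈ 𝔪'` for `i = 1, 2`); `g ∈ J` with
`g ≡ a y^μ (mod 𝔪^{μ+1})`, `a` a unit; `y ∉ (u 1, u 2) + 𝔪²`.  Then `(J R' : x'^μ) = R'`.
[cite: Cutkosky2009, Lemma 5.1 (2), p. 17 l. 46–50] -/
theorem colon_map_eq_top_of_monic (φ : R →+* R') [IsLocalHom φ] {u : Fin 3 → R}
    (hu : Ideal.span {u 0, u 1, u 2} = maximalIdeal R) {x' u₁' u₂' : R'} (hu₁' : u₁' ∈ maximalIdeal R')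
    (hu₂' : u₂' ∈ maximalIdeal R') (h0 : φ (u 0) = x') (h1 : φ (u 1) = x' * u₁')
    (h2 : φ (u 2) = x' * u₂') {J : Ideal R} {μ : ℕ} {g y a : R} (hg : g ∈ J) (ha : IsUnit a)
    (hrem : g - a * y ^ μ ∈ maximalIdeal R ^ (μ + 1)) (hy𝔪 : y ∈ maximalIdeal R)
    (hy : y ∉ Ideal.span {u 1, u 2} ⊔ maximalIdeal R ^ 2) :
    (J.map φ).colon (Ideal.span {x' ^ μ}) = ⊤ := by
  classical
  -- the image of `𝔪^N` lies in `(x'^N)`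
  have hmap𝔪 : (maximalIdeal R).map φ ≤ Ideal.span {x'} := by
    rw [← hu, Ideal.map_span, Ideal.span_le]
    rintro _ ⟨v, hv, rfl⟩
    simp only [Set.mem_insert_iff, Set.mem_singleton_iff] at hv
    rcases hv with rfl | rfl | rfl
    · rw [h0]; exact Ideal.mem_span_singleton_self _
    · rw [h1]; exact Ideal.mul_mem_right _ _ (Ideal.mem_span_singleton_self _)
    · rw [h2]; exact Ideal.mul_mem_right _ _ (Ideal.mem_span_singleton_self _)
  have hmap𝔪pow : ∀ N : ℕ, (maximalIdeal R ^ N).map φ ≤ Ideal.span {x' ^ N} := by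
    intro N
    rw [Ideal.map_pow, ← Ideal.span_singleton_pow]
    exact Ideal.pow_right_mono hmap𝔪 N
  -- `y = b₀ u₀ + b₁ u₁ + b₂ u₂` with `b₀` a unit
  have hy' : y ∈ Ideal.span ({u 0, u 1, u 2} : Set R) := by rw [hu]; exact hy𝔪
  obtain ⟨b₀, b₁, b₂, hyb⟩ := Submodule.mem_span_triple.mp hy'
  simp only [smul_eq_mul] at hyb
  have hb₀ : IsUnit b₀ := by
    by_contra hnu
    apply hy
    have hb₀𝔪 : b₀ ∈ maximalIdeal R := (mem_maximalIdeal _).mpr hnu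
    have hu0 : u 0 ∈ maximalIdeal R := by rw [← hu]; exact Ideal.subset_span (by simp)
    rw [← hyb]
    refine Ideal.add_mem _ (Ideal.add_mem _ ?_ ?_) ?_
    · exact Ideal.mem_sup_right (by rw [pow_two]; exact Ideal.mul_mem_mul hb₀𝔪 hu0)
    · exact Ideal.mem_sup_left (Ideal.mul_mem_left _ _ (Ideal.subset_span (by simp)))
    · exact Ideal.mem_sup_left (Ideal.mul_mem_left _ _ (Ideal.subset_span (by simp)))
  -- `φ y = x' · v` with `v` a unit
  set v : R' := φ b₀ + φ b₁ * u₁' + φ b₂ * u₂' with hv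
  have hφy : φ y = x' * v := by
    rw [← hyb]; simp only [map_add, map_mul, h0, h1, h2, hv]; ring
  have hvU : IsUnit v := by
    rw [hv, add_assoc]
    exact isUnit_add_of_mem_maximalIdeal (hb₀.map φ)
      (Ideal.add_mem _ (Ideal.mul_mem_left _ _ hu₁') (Ideal.mul_mem_left _ _ hu₂'))
  -- `φ (g − a y^μ) = x'^{μ+1} w`
  obtain ⟨w, hw⟩ : ∃ w, φ (g - a * y ^ μ) = x' ^ (μ + 1) * w := by
    have := hmap𝔪pow (μ + 1) (Ideal.mem_map_of_mem φ hrem)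
    obtain ⟨w, hw⟩ := Ideal.mem_span_singleton'.mp this
    exact ⟨w, by rw [← hw, mul_comm]⟩
  -- `φ g = x'^μ · (unit)`
  have hφg : φ g = x' ^ μ * (φ a * v ^ μ + x' * w) := by
    have : φ g = φ (a * y ^ μ) + φ (g - a * y ^ μ) := by rw [← map_add]; ring_nf
    rw [this, map_mul, map_pow, hφy, hw]; ring
  have hx' : x' ∈ maximalIdeal R' := by
    rw [← h0]; exact map_nonunit φ (u 0) (by rw [← hu]; exact Ideal.subset_span (by simp))
  have hg'U : IsUnit (φ a * v ^ μ + x' * w) :=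
    isUnit_add_of_mem_maximalIdeal ((ha.map φ).mul (hvU.pow μ)) (Ideal.mul_mem_right _ _ hx')
  refine Ideal.eq_top_of_isUnit_mem _ ?_ hg'U
  rw [Submodule.mem_colon_span_singleton, smul_eq_mul, mul_comm, ← hφg]
  exact Ideal.mem_map_of_mem φ hg

end General

/-! ## The chart frame of `CutkoskyOrderTauBlowup.lean` -/

section Chart

variable {k : Type u} [Field k]

/-- A point-chart presentation is a local homomorphism. [folklore] -/
private theorem isLocalHom_of_isPointChart {φ : MvPowerSeries (Fin 3) k →ₐ[k] MvPowerSeries (Fin 3) k}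
    {u u' : Fin 3 → MvPowerSeries (Fin 3) k} (hch : IsPointChart φ u u') :
    IsLocalHom (φ : MvPowerSeries (Fin 3) k →+* MvPowerSeries (Fin 3) k) := by
  obtain ⟨hu, hu', h0, h1, h2⟩ := hch
  have hu'i : ∀ i, u' i ∈ maximalIdeal (MvPowerSeries (Fin 3) k) := fun i => by
    rw [← hu']; exact Ideal.subset_span (by fin_cases i <;> simp)
  refine ⟨fun a ha => ?_⟩
  by_contra hna
  have ha𝔪 : a ∈ Ideal.span ({u 0, u 1, u 2} : Set (MvPowerSeries (Fin 3) k)) := by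
    rw [hu]; exact (mem_maximalIdeal _).mpr hna
  have hφa : (φ : MvPowerSeries (Fin 3) k →+* MvPowerSeries (Fin 3) k) a ∈
      maximalIdeal (MvPowerSeries (Fin 3) k) := by
    have := Ideal.mem_map_of_mem (φ : MvPowerSeries (Fin 3) k →+* MvPowerSeries (Fin 3) k) ha𝔪
    rw [Ideal.map_span] at this
    refine (Ideal.span_le.mpr ?_) this
    rintro _ ⟨v, hv, rfl⟩
    simp only [Set.mem_insert_iff, Set.mem_singleton_iff] at hv
    rcases hv with rfl | rfl | rfl
    · show φ (u 0) ∈ _; rw [h0]; exact hu'i 0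
    · show φ (u 1) ∈ _; rw [h1]; exact Ideal.mul_mem_left _ _ (hu'i 1)
    · show φ (u 2) ∈ _; rw [h2]; exact Ideal.mul_mem_left _ _ (hu'i 2)
  exact (mem_maximalIdeal _).mp hφa ha

/-- **Cutkosky 2009, Lemma 5.1 (2) — a near point of the blown-up point lies on the strict transform
of every approximate HYPERPLANE `V(ℓ)`** (the hyperplane clause of the point branch of the named fact
`Cutkosky2009_Lemma5_1`, PROVED): in `k⟦x, y, z⟧`, if `I` has order exactly `r ≥ 1`, all its
`r`-leading forms are multiples of `ℓ̄^r` (`I ⊆ (ℓ^r) + 𝔪^{r+1}`, `ℓ ∈ 𝔪`), `u, u'` present `φ` as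
the first chart of the blow-up of the closed point and the weak transform `I'` still has order
exactly `r` at the origin, then `ℓ ∈ (u 1, u 2) + 𝔪²`.
[cite: Cutkosky2009, Lemma 5.1 (2), p. 17 l. 46–50] -/
theorem Cutkosky2009_L5_1_pointHyperplane {r : ℕ} (hr : 1 ≤ r)
    {I I' : Ideal (MvPowerSeries (Fin 3) k)}
    {φ : MvPowerSeries (Fin 3) k →ₐ[k] MvPowerSeries (Fin 3) k} {u u' : Fin 3 → MvPowerSeries (Fin 3) k}
    (hI : HasOrder I r) (hch : IsPointChart φ u u') (hwt : IsWeakTransform I I' φ (u' 0) r)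
    (hI' : HasOrder I' r) {ℓ : MvPowerSeries (Fin 3) k} (hℓ : ℓ ∈ maximalIdeal (MvPowerSeries (Fin 3) k))
    (hIℓ : I ≤ Ideal.span {ℓ ^ r} ⊔ maximalIdeal (MvPowerSeries (Fin 3) k) ^ (r + 1)) :
    ℓ ∈ Ideal.span {u 1, u 2} ⊔ maximalIdeal (MvPowerSeries (Fin 3) k) ^ 2 := by
  classical
  haveI := isLocalHom_of_isPointChart hch
  obtain ⟨hu, hu', h0, h1, h2⟩ := hch
  obtain ⟨-, hI'def⟩ := hwt
  have hu'i : ∀ i, u' i ∈ maximalIdeal (MvPowerSeries (Fin 3) k) := fun i => by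
    rw [← hu']; exact Ideal.subset_span (by fin_cases i <;> simp)
  by_contra hy
  -- a monic element of `I`
  obtain ⟨g, hg, hgn⟩ : ∃ g ∈ I, g ∉ maximalIdeal (MvPowerSeries (Fin 3) k) ^ (r + 1) := by
    by_contra h
    push Not at h
    exact hI.2 h
  obtain ⟨s, hs, h', hh', hgsum⟩ := Submodule.mem_sup.mp (hIℓ hg)
  obtain ⟨a, rfl⟩ := Ideal.mem_span_singleton'.mp hs
  have ha : IsUnit a := by
    by_contra hna
    apply hgn
    rw [← hgsum]
    refine Ideal.add_mem _ ?_ hh'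
    rw [pow_succ']
    exact Ideal.mul_mem_mul ((mem_maximalIdeal _).mpr hna) (Ideal.pow_mem_pow hℓ r)
  have hrem : g - a * ℓ ^ r ∈ maximalIdeal (MvPowerSeries (Fin 3) k) ^ (r + 1) := by
    rw [← hgsum, add_sub_cancel_left]; exact hh'
  have htop := colon_map_eq_top_of_monic (φ : MvPowerSeries (Fin 3) k →+* MvPowerSeries (Fin 3) k) hu
    (hu'i 1) (hu'i 2) h0 h1 h2 hg ha hrem hℓ hy
  -- but `I'` has order `r ≥ 1`
  have hI'top : I' = ⊤ := by rw [hI'def]; exact htop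
  have h1le : I' ≤ maximalIdeal (MvPowerSeries (Fin 3) k) :=
    hI'.1.trans (Ideal.pow_le_self (by omega))
  rw [hI'top, top_le_iff] at h1le
  exact (maximalIdeal.isMaximal (MvPowerSeries (Fin 3) k)).ne_top h1le

end Chart

end Literature.AlgebraicGeometry.Resolution.Cutkosky2009
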